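import Literature.NumberTheory.IwasawaTheory.Greenberg2006.InducedCohomologyVanishing
import Literature.NumberTheory.GaloisRepresentations.ContinuousCohomologyAdditiveTransport
import Literature.NumberTheory.GaloisRepresentations.ShapiroIsomorphism
import Literature.GroupTheory.ProfiniteSubquotients
import HarnessLib

/-!
# Greenberg 2006, Theorem 3 (Λ-free, all degrees) — DISCHARGED:
# `Hⁱ(K_S/K, Ind_{K̃_∞/K}(D)) ≃+ Hⁱ(K_S/K̃_∞, D)` for the two-variable twist deformation

Topic `NumberTheory/IwasawaTheory/Greenberg2006`; namespace
`Literature.NumberTheory.IwasawaTheory.Greenberg2006`. Proof file (theorems only, nothing asserted,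
no definition, no `sorry`): it closes the PUBLISHED named fact
`thm3_twistDeformation_cohomology_addEquiv` of `InducedCohomologyComparison.lean` ([Gr4] Thm. 3 as
stated there: the Shapiro comparison for Greenberg's `𝐃 = twistDeformation S hS κ₁ κ₂ ρ₀`, Λ-free, in
every degree `i`), a conjunct of `stub_publishedFactsGreenberg` of the cell `bsd-eis` skeleton
`GoodLatticeBDPValue` (crux 2, stmt-BirchSwinnertonDyer-19032). The proof lives in this SEPARATE file
because the fact's own file is imported by the kernel door `InducedCohomologyVanishing.lean` needed
here (the same-file append would close an import cycle; precedent
`EllipticCurves/SteinWuthrich2013/SplitMultCanonicalHolds.lean`).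

* `thm3_twistDeformation_cohomology_addEquiv_holds : thm3_twistDeformation_cohomology_addEquiv`.

PROOF (Serre's, as the TODO at the end of `InducedCohomologyVanishing.lean` asked): the chain of
additive isomorphisms
`Hⁱ(G_{K,S}, 𝐃)_{Λ₂} ≃+ Hⁱ(G_{K,S}, M_G^H(A))_ℤ ≃+ Hⁱ(H, A)_ℤ ≃+ Hⁱ(H, A)_𝒪`, `H = Gal(K_S/K̃_∞)`:
(1) transport along the model isomorphism `shapiroEquiv : 𝐃 ≃ M_G^H(A)` (`InducedCohomologyVanishing`,
equivariant by `shapiroMap_twistDeformation`; both modules are discrete), across the two coefficient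
rings `Λ₂ = 𝒪⟦T₁,T₂⟧` and `ℤ` (`ContinuousRep.HAddEquivOfContinuousAddEquiv`,
`ContinuousCohomologyAdditiveTransport.lean`: continuous cohomology does not see the scalars);
(2) the Shapiro ISOMORPHISM for the closed subgroup `H` of the profinite `G_{K,S}` and the discrete
`H`-module `A` (`shapiroAddEquiv`, `ShapiroIsomorphism.lean` = Serre I §2.5 Prop. 10 in every degree);
(3) `ℤ ↝ 𝒪` on `H` (`ContinuousRep.restrictScalarsH`; `towerRep = (ρ₀|_H)|_ℤ` by definition).
No use is made of the finiteness of `S` (a hypothesis of the fact, kept as printed).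

What is NOT proved here (unchanged `TODO(general form)` of the fact's docstring): the `Λ₂`-LINEAR form
of [Gr4] Thm. 3 / [Lim12] Prop. 5.2.2 ("as Λ-modules": the conjugation `Γ`-action on the subgroup side),
general `ℤ_p^m`, the local and `Ш` comparisons.

## References
* R. Greenberg, *On the structure of certain Galois cohomology groups*, Doc. Math. Extra Vol. Coates
  (2006) 335–391, Thm. 3 p. 342 L13–14 (statement). [Greenberg2006]
* M. F. Lim, *Poitou–Tate duality over extensions of global fields*, J. Number Theory 132 (2012),
  Prop. 5.2.2, Lemma 5.3.1 (proof in print). [Lim2012PoitouTate]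
* J.-P. Serre, *Galois Cohomology* (1997), I §2.5 Prop. 10 (Shapiro). [SerreGaloisCohomology1997]
-/

noncomputable section

open scoped Classical
open NumberField IsDedekindDomain
open Literature.NumberTheory.GaloisRepresentations
open Literature.NumberTheory.EllipticCurves (ZpExtension)

namespace Literature.NumberTheory.IwasawaTheory.Greenberg2006

section Helpers

variable {K : Type} [Field K] [NumberField K] (S : Set (HeightOneSpectrum (𝓞 K))) {p : ℕ} [Fact p.Prime]
  (κ₁ κ₂ : ZpExtension K p)

/-- `Gal(K_S/K̃_∞) = galoisGroupAbove S (⋂ ker κᵢ) ≤ G_{K,S}` is closed (continuous image of the compact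
`⋂ ker κᵢ ≤ Γ_K` in the Hausdorff `G_{K,S}`; cf. `TwistDeformationLEO.isClosed_galoisGroupAbove`).
[cite: Greenberg2006, p. 341 L39–47] -/
private theorem isClosed_galoisGroupAbove_pair' :
    IsClosed ((galoisGroupAbove S (multiZpKer p ![κ₁, κ₂]) :
      Subgroup (GaloisGroupUnramifiedOutside K S)) : Set (GaloisGroupUnramifiedOutside K S)) := by
  rw [galoisGroupAbove, Subgroup.coe_map]
  exact ((isClosed_multiZpKer p ![κ₁, κ₂]).isCompact.image (continuous_toUnramifiedQuot K S)).isClosed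

/-- `G_{K,S} = Γ_K ⧸ N_S` is totally disconnected (quotient of a profinite group by a closed normal
subgroup; cf. `TwistDeformationLEO.totallyDisconnectedSpace_galoisGroupUnramifiedOutside`).
[cite: SerreGaloisCohomology1997, Ch. I §1.1] -/
private theorem totallyDisconnectedSpace_galoisGroupUnramifiedOutside' :
    TotallyDisconnectedSpace (GaloisGroupUnramifiedOutside K S) :=
  Literature.GroupTheory.ProfiniteSubquotients.totallyDisconnectedSpace_quotient
    (ramificationSubgroup K S) (ramificationSubgroup_isClosed K S)

end Helpers

/-- **Greenberg 2006, Theorem 3 (Λ-free, every degree), PROVED**: for a number field `K`, a prime `p`,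
`S ⊇ {v ∣ p}` finite, two `ℤ_p`-extensions `κ₁, κ₂` of `K` jointly onto `ℤ_p²` (`K_∞ = K̃_∞`), and ANY
discrete `p`-primary `𝒪`-module `D = (A, ρ₀)` with a continuous `𝒪`-linear action of `G_{K,S}`,
`Hⁱ(K_S/K, 𝐃) ≃+ Hⁱ(K_S/K̃_∞, D)` for every `i`, where `𝐃 = twistDeformation S hS κ₁ κ₂ ρ₀ = Ind_{K̃_∞/K}(D)`
— i.e. the named fact `thm3_twistDeformation_cohomology_addEquiv` holds. Chain: transport along the
model isomorphism `𝐃 ≃ M_G^H(A)` across the coefficient rings `Λ₂`/`ℤ`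
(`ContinuousRep.HAddEquivOfContinuousAddEquiv`, `shapiroEquiv`, `shapiroMap_twistDeformation`) ∘
Serre's Shapiro isomorphism for the closed subgroup `H = Gal(K_S/K̃_∞)` of the profinite `G_{K,S}`
(`shapiroAddEquiv`) ∘ `ℤ ↝ 𝒪` on `H` (`ContinuousRep.restrictScalarsH`).
[cite: Greenberg2006, Thm. 3 p. 342 L13–14] [cite: Lim2012PoitouTate, Prop. 5.2.2 and Lemma 5.3.1]
[cite: SerreGaloisCohomology1997, I §2.5 Prop. 10] -/
theorem thm3_twistDeformation_cohomology_addEquiv_holds : thm3_twistDeformation_cohomology_addEquiv := by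
  intro p _ K _ _ S _ hS κ₁ κ₂ hκ 𝒪 _ _ _ _ A _ _ _ _ _ _ ρ₀ hA i
  haveI : IsClosed ((galoisGroupAbove S (multiZpKer p ![κ₁, κ₂]) :
      Subgroup (GaloisGroupUnramifiedOutside K S)) : Set (GaloisGroupUnramifiedOutside K S)) :=
    isClosed_galoisGroupAbove_pair' S κ₁ κ₂
  haveI : TotallyDisconnectedSpace (GaloisGroupUnramifiedOutside K S) :=
    totallyDisconnectedSpace_galoisGroupUnramifiedOutside' S
  haveI : DiscreteTopology (coindModule (towerRep S κ₁ κ₂ ρ₀)) := discreteTopology_coind _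
  -- (1) `Hⁱ(G_{K,S}, 𝐃)_{Λ₂} ≃+ Hⁱ(G_{K,S}, M_G^H(A))_ℤ` along the model isomorphism (both modules discrete)
  let η : IndModule₂ 𝒪 p A ≃ₜ+ coindModule (towerRep S κ₁ κ₂ ρ₀) :=
    { shapiroEquiv S hS κ₁ κ₂ ρ₀ hκ hA with
      continuous_toFun := continuous_of_discreteTopology
      continuous_invFun := continuous_of_discreteTopology }
  have e₁ : (twistDeformation S hS κ₁ κ₂ ρ₀).H i ≃+ (coindRep (towerRep S κ₁ κ₂ ρ₀)).H i :=
    ContinuousRep.HAddEquivOfContinuousAddEquiv (twistDeformation S hS κ₁ κ₂ ρ₀)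
      (coindRep (towerRep S κ₁ κ₂ ρ₀)) η
      (fun g Φ ↦ shapiroMap_twistDeformation S hS κ₁ κ₂ ρ₀ g Φ) i
  -- (2) Shapiro: `Hⁱ(G_{K,S}, M_G^H(A)) ≃+ Hⁱ(H, A)` over `ℤ`
  have e₂ : (coindRep (towerRep S κ₁ κ₂ ρ₀)).H i ≃+ (towerRep S κ₁ κ₂ ρ₀).H i :=
    shapiroAddEquiv (towerRep S κ₁ κ₂ ρ₀) i
  -- (3) `ℤ ↝ 𝒪` on `H`
  have e₃ : (towerRep S κ₁ κ₂ ρ₀).H i ≃+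
      (ρ₀.restrict (galoisGroupAboveSubtype S (multiZpKer p ![κ₁, κ₂]))).H i :=
    ContinuousRep.restrictScalarsH ℤ (ρ₀.restrict (galoisGroupAboveSubtype S (multiZpKer p ![κ₁, κ₂]))) i
  exact ⟨e₁.trans (e₂.trans e₃)⟩

end Literature.NumberTheory.IwasawaTheory.Greenberg2006

end
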